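import Summits.Ventures.PercRepro.Night2ThreeTwoBasisAssemblyB
import Summits.Ventures.PercRepro.Night2ThreeTwoMissedResidues

/-!
# PercRepro — the `(3, 2)` obstruction cell for `|V| ≥ 11` modulo the quadratic count sums (night-2, gen 25)

With the column bound at every target (`dload_missed_le_cap2_three_two`) and the basis pairs' inequality from the
quadratic count (`basis_pair_fair_of_qSum`), the obstruction cell with `|V| ≥ 11` is (LI_G) modulo PURE ARITHMETIC: for
the three profiles `(i₀, j₀) ∈ {(2,2), (1,3), (0,4)}` of a basis of `V` against the common line `ℓ` (a basis meets a
line in at most two points), `E(n) = (n + 56)/(20 n) ≤ qSum (n − y) y i₀ j₀ n`, `y = |V ∖ ℓ|`.  Numerically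
(proofs/NIGHT-2-g25.md §5‴) the sums are `≥ 1 > E(n)` for every `n ≥ 13` and `y ≤ 6` and grow super-exponentially;
their kernel verification in a range and a tail are the successor's items.

* `profile_of_basis`: the profile of a covering basis has `i₀ ≤ 2`, `i₀ + j₀ = 4`;
* `faceLoss_sum_le_three_two`: the chord excess bounds the face losses of every covering basis (gen 24's arithmetic);
* **`localShadowHall_three_two_five_of_qSums`**: (LI_G) in the cell from the three arithmetic inequalities.
-/

namespace PercRepro.Shadow

open Finset PerFlat ThmH

variable {α : Type*} [DecidableEq α] {M : Matroid α} [M.Finite]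

section BasisCell

variable {G : Finset α}

open scoped Classical in
/-- The profile of the covering set of a basis pair: at most two points on the line, four off the coloops. -/
theorem profile_of_basis (hG : G ∈ flatsQ M (5 + 1)) (hd : (gr M \ G).card ≤ 5) (hk : kColoops M G = 2)
    {ℓ : Finset α} (hℓr : rkN M ℓ ≤ 2) {B : Finset α} (hB : B ∈ thinMembers M 5 G)
    (hB3 : (B \ coloops M G).card + 1 = 4) {z : α} (hz : z ∈ G \ clF M B) :
    (profileAt (coloops M G) ℓ (insert z B)).1 ≤ 2 ∧
      (profileAt (coloops M G) ℓ (insert z B)).1 + (profileAt (coloops M G) ℓ (insert z B)).2 = 4 := by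
  have hk' : kColoops M G + 4 = 5 + 1 := by omega
  have hQ := insert_mem_shadowAt_thin hG hB hz
  have hcard : (insert z B \ coloops M G).card = 4 := by
    rw [card_insert_sdiff_coloops_thin hG hd hB hz]; omega
  have hind := indep_of_mem_shadowAt_card hk' hQ hcard
  have hind' : M.Indep ((insert z B \ coloops M G : Finset α) : Set α) :=
    hind.subset (by exact_mod_cast (Finset.sdiff_subset : insert z B \ coloops M G ⊆ insert z B))
  simp only [profileAt]
  refine ⟨card_inter_le_two_of_indep hind' hℓr, ?_⟩
  rw [add_comm, Finset.card_sdiff_add_card_inter, hcard]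

open scoped Classical in
/-- The face losses of every covering basis sum to at most the chord excess `(n + 56)/(20 n)` (gen 24's arithmetic),
`n = |V| ≥ 7`. -/
theorem faceLoss_sum_le_three_two (hG : G ∈ flatsQ M (5 + 1)) (hd : (gr M \ G).card = 3) (hk : kColoops M G = 2)
    (hs : ∀ e ∈ gr M, ∀ f ∈ gr M, e ≠ f → rkN M {e, f} = 2) (hl : ∀ e ∈ gr M, M.Indep {e})
    (hn7 : 7 ≤ (G \ coloops M G).card) {S : Finset α} (T : Finset α) (hT : T ∈ coverBases M G S 4) :
    ∑ w ∈ T, faceLoss M 5 G (coloops M G ∪ T) w ≤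
      (((G \ coloops M G).card : ℚ) + 56) / (20 * ((G \ coloops M G).card : ℚ)) := by
  have hk' : kColoops M G + 4 = 5 + 1 := by omega
  have hT' : T ∈ (S \ coloops M G).powersetCard 4 := by
    unfold coverBases at hT
    exact (Finset.mem_filter.1 hT).1
  set n := (G \ coloops M G).card with hn
  have h := sum_faceLoss_union_le (a := ((n : ℚ) + 2) / (5 * (n : ℚ))) (b := 1 / (5 * (n : ℚ))) hG hd (by norm_num)
    hk' (by omega) hs hl (by positivity) (by exact chord_three_two hn7)
    (by rw [hk, excessBound_three_two_eq hn7]; exact (excess_three_two_pos hn7).le) hT'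
  rw [hk, excessBound_three_two_eq hn7] at h
  exact h

open scoped Classical in
/-- **THE `(3, 2)` OBSTRUCTION CELL FOR `|V| ≥ 11` MODULO THE QUADRATIC COUNT SUMS**: with two thin members missing
`≤ 3` points with distinct hyperplanes (the faces of a saturated target) and the arithmetic
`(n + 56)/(20 n) ≤ qSum (n − y) y i₀ j₀ n` for the three basis profiles, (LI_G) holds. -/
theorem localShadowHall_three_two_five_of_qSums (hG : G ∈ flatsQ M (5 + 1)) (hd : (gr M \ G).card = 3)
    (hk : kColoops M G = 2) (hs : ∀ e ∈ gr M, ∀ f ∈ gr M, e ≠ f → rkN M {e, f} = 2)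
    (hl : ∀ e ∈ gr M, M.Indep {e}) (h11 : 11 ≤ (G \ coloops M G).card)
    {B₁ B₂ : Finset α} (hthin₁ : B₁ ∈ thinMembers M 5 G) (hthin₂ : B₂ ∈ thinMembers M 5 G)
    (hm₁ : (G \ clF M B₁).card ≤ 3) (hm₂ : (G \ clF M B₂).card ≤ 3) (hne : clF M B₁ ≠ clF M B₂)
    (hsums : ∀ i₀ j₀ : ℕ, i₀ ≤ 2 → i₀ + j₀ = 4 →
      j₀ ≤ ((G \ coloops M G) \ ((clF M B₁ ∩ clF M B₂) \ coloops M G)).card →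
      (((G \ coloops M G).card : ℚ) + 56) / (20 * ((G \ coloops M G).card : ℚ)) ≤
        qSum ((clF M B₁ ∩ clF M B₂) \ coloops M G).card
          ((G \ coloops M G) \ ((clF M B₁ ∩ clF M B₂) \ coloops M G)).card i₀ j₀ (G \ coloops M G).card) :
    LocalShadowHall M 5 G := by
  have hd' : (gr M \ G).card ≤ 5 := by omega
  set ℓ := (clF M B₁ ∩ clF M B₂) \ coloops M G with hℓdef
  obtain ⟨hℓr, hℓ5, hℓ⟩ := exists_common_line hG hd' hk hs h11 hthin₁ hthin₂ hm₁ hm₂ hne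
  have hℓV : ℓ ⊆ G \ coloops M G := fun a ha =>
    Finset.mem_sdiff.2 ⟨(mem_membersIn.1 (mem_thinMembers.1 hthin₁).1).2
      (Finset.mem_inter.1 (Finset.mem_sdiff.1 ha).1).1, (Finset.mem_sdiff.1 ha).2⟩
  have hℓcl : ∀ x ∈ G \ coloops M G, x ∈ clF M ℓ → x ∈ ℓ := fun x hx hcl => line_closed_in_V hx hcl
  have hn7 : 7 ≤ (G \ coloops M G).card := by omega
  apply localShadowHall_three_two_five_of_basisFair hG hd hk hs hl
  intro B hB hnB z hz
  by_cases hl0 : loss M 5 G B z = 0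
  · rw [hl0]
    exact mul_nonneg (rhoL_nonneg hG hd' B z)
      (lossIncomeH_nonneg hG hd' (fun S _ => dload_missed_le_cap2_three_two hG hd hk hs hl (fun _ h => h) S) B z)
  · have hB3 : (B \ coloops M G).card + 1 = 4 := by
      have := card_sdiff_coloops_thin_ge hG hd' (by omega : kColoops M G + 4 = 5 + 1) hB
      unfold BigMember at hnB
      omega
    obtain ⟨hi₀, hij⟩ := profile_of_basis hG hd' hk hℓr hB hB3 hz
    have hj₀y : (profileAt (coloops M G) ℓ (insert z B)).2 ≤ ((G \ coloops M G) \ ℓ).card := by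
      simp only [profileAt]
      apply Finset.card_le_card
      apply Finset.sdiff_subset_sdiff _ (Finset.Subset.refl _)
      apply Finset.sdiff_subset_sdiff _ (Finset.Subset.refl _)
      exact Finset.insert_subset (Finset.mem_sdiff.1 hz).1
        ((subset_clF (mem_membersIn.1 (mem_thinMembers.1 hB).1).1).trans (mem_membersIn.1 (mem_thinMembers.1 hB).1).2)
    exact basis_pair_fair_of_qSum hG hd hk hs hl h11 (fun B => Iff.rfl) hℓr (by omega) hℓV hℓcl hℓ hB hnB hz hl0
      (by positivity) (fun S _ T hT => faceLoss_sum_le_three_two hG hd hk hs hl hn7 T hT)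
      (hsums _ _ hi₀ hij hj₀y)

end BasisCell

end PercRepro.Shadow
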